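import Literature.Probability.RandomPlanarGeometry.LoewnerMapProofs
import HarnessLib

/-!
# Stability of the chordal Loewner flow in the driving function

For the chordal Loewner chain of `Literature.Probability.RandomPlanarGeometry.LoewnerChain`
(`ġ = 2/(g - W)`), this file proves the elementary **continuous dependence of the flow on the
driving function**, uniformly up to a fixed time:

* `Literature.Probability.RandomPlanarGeometry.Loewner.norm_vectorField_sub_vectorField_le` —
  `|2/(w - W) - 2/(w - W')| = 2|W - W'|/(|w - W| |w - W'|)`;
* `Literature.Probability.RandomPlanarGeometry.Loewner.IsSolution.dist_le_of_driving_close` —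
  the **two-driver tube estimate**: if `g` solves the equation driven by `W` from `z` on `[0, b]`
  and stays `δ`-away from `W`, and `h` solves the equation driven by `W'` from `z'`, with
  `|W - W'| ≤ ω ≤ δ/4` on `[0, b]` and `e₀ e^{Kb} + ω (e^{Kb} - 1) < δ/4` (`e₀ = |z' - z|`,
  `K = 8/δ²` the Lipschitz constant of the field on the `δ/2`-tube), then
  `|h(s) - g(s)| ≤ e₀ e^{Ks} + ω (e^{Ks} - 1)` as long as `h` lives in `[0, b]` (Grönwall's
  inequality for `h` as an approximate solution of the `W`-equation, Mathlib's
  `dist_le_of_approx_trajectories_ODE_of_mem`, and a first-exit argument);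
* `Literature.Probability.RandomPlanarGeometry.Loewner.IsSolution.lt_swallowingTime_of_driving_close`
  — consequently `z'` is still flowing at time `b` for `W'` (extension criterion
  `IsSolution.coe_lt_swallowingTime_of_le_norm_sub`), and the estimate holds for the Loewner
  maps: `|g'_s(z') - g_s(z)| ≤ e₀ e^{Ks} + ω (e^{Ks} - 1)` for `s ≤ b`
  (`dist_map_le_of_driving_close`).

This is the deterministic input for the approximation of a Loewner chain by chains with
piecewise frozen driving functions (the Euler scheme behind [LSW] proof of Lemma 3.5, p. 13:
"Let `Φ^{(n)}_t` be the solution of (3.4) with `Ũ^{(n)}_t` replacing `Ũ_t`. Then, clearly,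
`Φ^{(n)}_s(z) → Φ_s(z)`"), cf. Lawler (2005), §4.7 (convergence of Loewner chains under
convergence of the driving functions).

## References

* G. F. Lawler, *Conformally Invariant Processes in the Plane*, AMS (2005), Ch. 4 §4.1 and
  §4.7 (Prop. 4.47) [Lawler2005].
* G. F. Lawler, O. Schramm, W. Werner, *Conformal restriction: the chordal case*, JAMS 16
  (2003), proof of Lemma 3.5 (arXiv p. 13) [LawlerSchrammWerner2003Restriction].
-/

noncomputable section

namespace Literature.Probability.RandomPlanarGeometry

namespace Loewner

open Set Filter Metric
open scoped NNReal Topology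

variable {W W' : ℝ≥0 → ℝ} {z z' : ℂ} {g h : ℝ → ℂ} {T T' : WithTop ℝ≥0}

/-! ### Perturbation of the field in the driving function -/

/-- **`2/(w - W) - 2/(w - W') = 2(W - W')/((w - W)(w - W'))`**, so that
`|v_W(w) - v_{W'}(w)| ≤ 2|W - W'|/(a a')` when `|w - W| ≥ a`, `|w - W'| ≥ a'`. [folklore] -/
theorem norm_vectorField_sub_vectorField_le {t : ℝ} {w : ℂ} {a a' : ℝ} (ha : 0 < a)
    (ha' : 0 < a') (hw : a ≤ ‖w - W t.toNNReal‖) (hw' : a' ≤ ‖w - W' t.toNNReal‖) :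
    ‖vectorField W t w - vectorField W' t w‖ ≤
      2 * |W t.toNNReal - W' t.toNNReal| / (a * a') := by
  have hw0 : w - W t.toNNReal ≠ 0 := norm_pos_iff.1 (ha.trans_le hw)
  have hw'0 : w - W' t.toNNReal ≠ 0 := norm_pos_iff.1 (ha'.trans_le hw')
  have hid : vectorField W t w - vectorField W' t w =
      2 * ((W t.toNNReal : ℂ) - W' t.toNNReal) / ((w - W t.toNNReal) * (w - W' t.toNNReal)) := by
    rw [vectorField_apply, vectorField_apply, div_sub_div _ _ hw0 hw'0]
    ring
  rw [hid, norm_div, norm_mul, norm_mul, Complex.norm_two, ← Complex.ofReal_sub, Complex.norm_real,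
    Real.norm_eq_abs]
  have hprod : a * a' ≤ ‖w - W t.toNNReal‖ * ‖w - W' t.toNNReal‖ :=
    mul_le_mul hw hw' ha'.le (norm_nonneg _)
  exact div_le_div_of_nonneg_left (by positivity) (by positivity) hprod

/-! ### The two-driver tube estimate -/

/-- The explicit Grönwall bound `e₀ e^{Ks} + ω (e^{Ks} - 1)` is `gronwallBound e₀ K (K ω) s`
(`K ≠ 0`). [folklore] -/
theorem gronwallBound_mul_eq {e₀ K ω s : ℝ} (hK : K ≠ 0) :
    gronwallBound e₀ K (K * ω) s = e₀ * Real.exp (K * s) + ω * (Real.exp (K * s) - 1) := by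
  rw [gronwallBound_of_K_ne_0 hK, mul_div_cancel_left₀ _ hK]

/-- The explicit bound is monotone in `s ≥ 0` (for `e₀, ω, K ≥ 0`). [folklore] -/
theorem driverBound_mono {e₀ K ω : ℝ} (he₀ : 0 ≤ e₀) (hK : 0 ≤ K) (hω : 0 ≤ ω) {s s' : ℝ}
    (hss' : s ≤ s') :
    e₀ * Real.exp (K * s) + ω * (Real.exp (K * s) - 1) ≤
      e₀ * Real.exp (K * s') + ω * (Real.exp (K * s') - 1) := by
  have : Real.exp (K * s) ≤ Real.exp (K * s') :=
    Real.exp_le_exp.2 (mul_le_mul_of_nonneg_left hss' hK)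
  nlinarith

/-- **Two-driver tube estimate** (continuous dependence of the Loewner flow on the driving
function). Let `g` solve the Loewner equation driven by `W` from `z`, alive on `[0, b]` and
`δ`-away from `W` there (`δ > 0`); let `h` solve the equation driven by `W'` from `z'`, alive
on `[0, u]`, `u ≤ b`; suppose `|W - W'| ≤ ω` on `[0, b]` with `0 ≤ ω ≤ δ/4`, and, with
`e₀ = |z' - z|` and `K = 2/(δ/2)² = 8/δ²`, `e₀ e^{Kb} + ω (e^{Kb} - 1) < δ/4`. Then
`|h(s) - g(s)| ≤ e₀ e^{Ks} + ω (e^{Ks} - 1)` for `s ∈ [0, u]`. Proof: as long as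
`|h - g| < δ/4`, both paths are `δ/2`-away from `W` (where the field is `K`-Lipschitz,
`lipschitzOnWith_vectorField`) and `h` is `δ/2`-away from `W'`, so `h` solves the `W`-equation
up to the error `|v_{W'}(h) - v_W(h)| ≤ 8ω/δ² = Kω`; Grönwall (Mathlib
`dist_le_of_approx_trajectories_ODE_of_mem`) gives the bound, which is `< δ/4`; a first-exit
argument removes the proviso. (Lawler (2005), §4.7, Prop. 4.47: Loewner chains depend
continuously on the driving function.) [cite: Lawler2005, Ch. 4 §4.7 (Prop. 4.47)] -/
theorem IsSolution.dist_le_of_driving_close (hg : IsSolution W z g T) {b : ℝ}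
    (hbT : (b.toNNReal : WithTop ℝ≥0) < T) {δ : ℝ≥0} (hδ : 0 < δ)
    (hfar : ∀ t ∈ Icc 0 b, (δ : ℝ) ≤ ‖g t - W t.toNNReal‖) {ω : ℝ} (hω0 : 0 ≤ ω)
    (hωδ : ω ≤ δ / 4) (hWW' : ∀ t ∈ Icc 0 b, |W t.toNNReal - W' t.toNNReal| ≤ ω)
    (hh : IsSolution W' z' h T') {u : ℝ} (hub : u ≤ b) (huT' : (u.toNNReal : WithTop ℝ≥0) < T')
    (hsmall : dist z' z * Real.exp (2 / ((δ : ℝ) / 2) ^ 2 * b) +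
      ω * (Real.exp (2 / ((δ : ℝ) / 2) ^ 2 * b) - 1) < δ / 4) :
    ∀ s ∈ Icc 0 u, dist (h s) (g s) ≤
      dist z' z * Real.exp (2 / ((δ : ℝ) / 2) ^ 2 * s) +
        ω * (Real.exp (2 / ((δ : ℝ) / 2) ^ 2 * s) - 1) := by
  have hδ' : (0 : ℝ) < δ := hδ
  set K : ℝ≥0 := 2 / (δ / 2) ^ 2 with hKdef
  have hK : (K : ℝ) = 2 / ((δ : ℝ) / 2) ^ 2 := by rw [hKdef]; push_cast; ring
  have hK0 : (0 : ℝ) < K := by rw [hK]; positivity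
  have hsubg : Icc 0 b ⊆ {t : ℝ | 0 ≤ t ∧ (t.toNNReal : WithTop ℝ≥0) < T} :=
    Icc_subset_timeDomain hbT
  have hsubh : Icc 0 u ⊆ {t : ℝ | 0 ≤ t ∧ (t.toNNReal : WithTop ℝ≥0) < T'} :=
    Icc_subset_timeDomain huT'
  -- the bound function and its monotonicity
  set E : ℝ → ℝ := fun s ↦ dist z' z * Real.exp ((K : ℝ) * s) + ω * (Real.exp ((K : ℝ) * s) - 1)
    with hEdef
  have hEmono : ∀ {s s'}, s ≤ s' → E s ≤ E s' := fun hss' ↦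
    driverBound_mono dist_nonneg hK0.le hω0 hss'
  have hEb : E b < δ / 4 := by simp only [hEdef, hK]; exact hsmall
  -- Grönwall on an initial segment `[0, s₀] ⊆ [0, u]` on which `|h - g| < δ/4`
  have gron : ∀ s₀, 0 ≤ s₀ → s₀ ≤ u → (∀ s, 0 ≤ s → s < s₀ → dist (h s) (g s) < δ / 4) →
      ∀ s ∈ Icc 0 s₀, dist (h s) (g s) ≤ E s := by
    intro s₀ hs₀0 hs₀u hbefore
    have hsub0u : Icc 0 s₀ ⊆ Icc 0 u := Icc_subset_Icc le_rfl hs₀u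
    have hsub0b : Icc 0 s₀ ⊆ Icc 0 b := Icc_subset_Icc le_rfl (hs₀u.trans hub)
    have hcontg : ContinuousOn g (Icc 0 s₀) := hg.continuousOn.mono (hsub0b.trans hsubg)
    have hconth : ContinuousOn h (Icc 0 s₀) := hh.continuousOn.mono (hsub0u.trans hsubh)
    have key := dist_le_of_approx_trajectories_ODE_of_mem (v := vectorField W)
      (s := fun t ↦ {w : ℂ | ((δ / 2 : ℝ≥0) : ℝ) ≤ ‖w - W t.toNNReal‖}) (K := K)
      (f := g) (g := h) (f' := fun t ↦ vectorField W t (g t)) (g' := fun t ↦ vectorField W' t (h t))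
      (a := 0) (b := s₀) (εf := 0) (εg := K * ω) (δ := dist z' z)
      (fun t _ ↦ by rw [hKdef]; exact lipschitzOnWith_vectorField W t (half_pos hδ))
      hcontg (hg.hasDerivWithinAt_Ici (hsub0b.trans hsubg))
      (fun s _ ↦ by rw [dist_self])
      (fun s hs ↦ by
        have := hfar s (hsub0b ⟨hs.1, hs.2.le⟩)
        show ((δ / 2 : ℝ≥0) : ℝ) ≤ _
        push_cast
        linarith)
      hconth (hh.hasDerivWithinAt_Ici (hsub0u.trans hsubh))
      (fun s hs ↦ by
        -- `h s` is `δ/2`-away from `W` and from `W'`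
        have h1 := hfar s (hsub0b ⟨hs.1, hs.2.le⟩)
        have h2 := hbefore s hs.1 hs.2
        rw [dist_eq_norm] at h2
        have h3 : ‖g s - (W s.toNNReal : ℂ)‖ ≤ ‖h s - W s.toNNReal‖ + ‖h s - g s‖ := by
          calc ‖g s - (W s.toNNReal : ℂ)‖ = ‖(h s - W s.toNNReal) - (h s - g s)‖ := by ring_nf
            _ ≤ _ := norm_sub_le _ _
        have hW : (δ : ℝ) / 2 ≤ ‖h s - W s.toNNReal‖ := by linarith
        have h4 : ‖h s - (W s.toNNReal : ℂ)‖ ≤ ‖h s - W' s.toNNReal‖ + |W s.toNNReal - W' s.toNNReal| := by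
          calc ‖h s - (W s.toNNReal : ℂ)‖
              = ‖(h s - W' s.toNNReal) - ((W s.toNNReal : ℂ) - W' s.toNNReal)‖ := by ring_nf
            _ ≤ ‖h s - W' s.toNNReal‖ + ‖(W s.toNNReal : ℂ) - W' s.toNNReal‖ := norm_sub_le _ _
            _ = _ := by rw [← Complex.ofReal_sub, Complex.norm_real, Real.norm_eq_abs]
        have h5 := hWW' s (hsub0b ⟨hs.1, hs.2.le⟩)
        have hW'' : (δ : ℝ) / 2 ≤ ‖h s - W' s.toNNReal‖ := by linarith
        rw [dist_comm]
        have h6 := norm_vectorField_sub_vectorField_le (W := W) (W' := W') (half_pos hδ')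
          (half_pos hδ') hW hW''
        calc dist (vectorField W s (h s)) (vectorField W' s (h s))
            = ‖vectorField W s (h s) - vectorField W' s (h s)‖ := dist_eq_norm _ _
          _ ≤ 2 * |W s.toNNReal - W' s.toNNReal| / ((δ : ℝ) / 2 * ((δ : ℝ) / 2)) := h6
          _ ≤ 2 * ω / ((δ : ℝ) / 2 * ((δ : ℝ) / 2)) := by gcongr
          _ = K * ω := by rw [hK]; ring)
      (fun s hs ↦ by
        have h1 := hfar s (hsub0b ⟨hs.1, hs.2.le⟩)
        have h2 := hbefore s hs.1 hs.2
        rw [dist_eq_norm] at h2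
        show ((δ / 2 : ℝ≥0) : ℝ) ≤ _
        push_cast
        have h3 : ‖g s - (W s.toNNReal : ℂ)‖ ≤ ‖h s - W s.toNNReal‖ + ‖h s - g s‖ := by
          calc ‖g s - (W s.toNNReal : ℂ)‖ = ‖(h s - W s.toNNReal) - (h s - g s)‖ := by ring_nf
            _ ≤ _ := norm_sub_le _ _
        linarith)
      (by rw [hg.apply_zero, hh.apply_zero, dist_comm])
    intro s hs
    have := key s hs
    rw [sub_zero, zero_add, gronwallBound_mul_eq hK0.ne', dist_comm] at this
    exact this
  -- first exit from the tube `|h - g| < δ/4`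
  have hall : ∀ s, 0 ≤ s → s ≤ u → dist (h s) (g s) < δ / 4 := by
    by_contra hcon
    push Not at hcon
    obtain ⟨s₁, hs₁0, hs₁u, hs₁⟩ := hcon
    have hconth : ContinuousOn h (Icc 0 u) := hh.continuousOn.mono hsubh
    have hcontg : ContinuousOn g (Icc 0 u) :=
      hg.continuousOn.mono ((Icc_subset_Icc le_rfl hub).trans hsubg)
    have hcontd : ContinuousOn (fun s ↦ dist (h s) (g s)) (Icc 0 u) :=
      continuous_dist.comp_continuousOn (hconth.prodMk hcontg)
    set S : Set ℝ := Icc 0 u ∩ (fun s ↦ dist (h s) (g s)) ⁻¹' Ici ((δ : ℝ) / 4) with hSdef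
    have hS : IsClosed S := hcontd.preimage_isClosed_of_isClosed isClosed_Icc isClosed_Ici
    have h₁S : s₁ ∈ S := ⟨⟨hs₁0, hs₁u⟩, hs₁⟩
    have hSbdd : BddBelow S := ⟨0, fun s hs ↦ hs.1.1⟩
    set s₀ := sInf S with hs₀def
    have hs₀S : s₀ ∈ S := hS.csInf_mem ⟨s₁, h₁S⟩ hSbdd
    have hbefore : ∀ s, 0 ≤ s → s < s₀ → dist (h s) (g s) < δ / 4 := by
      intro s hs0 hss
      by_contra hge
      rw [not_lt] at hge
      have hsS : s ∈ S := ⟨⟨hs0, hss.le.trans hs₀S.1.2⟩, hge⟩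
      exact absurd (csInf_le hSbdd hsS) (not_le.2 hss)
    have h1 := gron s₀ hs₀S.1.1 hs₀S.1.2 hbefore s₀ ⟨hs₀S.1.1, le_rfl⟩
    have h2 : E s₀ ≤ E b := hEmono (hs₀S.1.2.trans hub)
    have h3 : (δ : ℝ) / 4 ≤ dist (h s₀) (g s₀) := hs₀S.2
    linarith
  intro s hs
  have := gron u (hs.1.trans hs.2) le_rfl (fun s' hs'0 hs'u ↦ hall s' hs'0 hs'u.le) s hs
  simpa only [hEdef, hK] using this

/-- **The perturbed flow is alive up to time `b`.** Under the hypotheses of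
`IsSolution.dist_le_of_driving_close` with `h` the MAXIMAL solution for `W'` from `z'`
(`W'` continuous), `b < T'_{z'}`: otherwise `h` would stay `δ/2`-away from `W'` up to its death,
contradicting the extension criterion `IsSolution.coe_lt_swallowingTime_of_le_norm_sub`.
[cite: Lawler2005, Ch. 4 §4.7 (Prop. 4.47)] -/
theorem IsSolution.lt_swallowingTime_of_driving_close (hW' : Continuous W')
    (hg : IsSolution W z g T) {b : ℝ≥0}
    (hbT : (b : WithTop ℝ≥0) < T) {δ : ℝ≥0} (hδ : 0 < δ)
    (hfar : ∀ t ∈ Icc 0 (b : ℝ), (δ : ℝ) ≤ ‖g t - W t.toNNReal‖) {ω : ℝ} (hω0 : 0 ≤ ω)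
    (hωδ : ω ≤ δ / 4) (hWW' : ∀ t ∈ Icc 0 (b : ℝ), |W t.toNNReal - W' t.toNNReal| ≤ ω)
    (hh : IsSolution W' z' h (swallowingTime W' z'))
    (hsmall : dist z' z * Real.exp (2 / ((δ : ℝ) / 2) ^ 2 * b) +
      ω * (Real.exp (2 / ((δ : ℝ) / 2) ^ 2 * b) - 1) < δ / 4) :
    (b : WithTop ℝ≥0) < swallowingTime W' z' := by
  have hδ' : (0 : ℝ) < δ := hδ
  have hbT' : (((b : ℝ)).toNNReal : WithTop ℝ≥0) < T := by rwa [Real.toNNReal_coe]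
  -- `z'` is off the singularity `W' 0`
  have hz'0 : z' ≠ W' 0 := by
    intro h0
    have h1 := hfar 0 ⟨le_rfl, b.coe_nonneg⟩
    rw [hg.apply_zero, Real.toNNReal_zero] at h1
    have h2 := hWW' 0 ⟨le_rfl, b.coe_nonneg⟩
    rw [Real.toNNReal_zero] at h2
    have h3 : dist z' z ≤ dist z' z * Real.exp (2 / ((δ : ℝ) / 2) ^ 2 * b) := by
      have : (1 : ℝ) ≤ Real.exp (2 / ((δ : ℝ) / 2) ^ 2 * b) := Real.one_le_exp (by positivity)
      nlinarith [dist_nonneg (x := z') (y := z)]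
    have h4 : 0 ≤ ω * (Real.exp (2 / ((δ : ℝ) / 2) ^ 2 * b) - 1) :=
      mul_nonneg hω0 (by linarith [Real.one_le_exp (show (0:ℝ) ≤ 2 / ((δ : ℝ) / 2) ^ 2 * b by positivity)])
    have h5 : ‖z - (W 0 : ℂ)‖ ≤ dist z' z + |W 0 - W' 0| := by
      calc ‖z - (W 0 : ℂ)‖ = ‖(z - z') + ((W' 0 : ℂ) - W 0)‖ := by rw [h0]; ring_nf
        _ ≤ ‖z - z'‖ + ‖(W' 0 : ℂ) - W 0‖ := norm_add_le _ _
        _ = dist z' z + |W 0 - W' 0| := by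
          rw [← dist_eq_norm, dist_comm, ← Complex.ofReal_sub, Complex.norm_real, Real.norm_eq_abs,
            abs_sub_comm]
    linarith
  by_contra hcon
  rw [not_lt] at hcon
  have hcT : swallowingTime W' z' ≠ ⊤ := ne_top_of_le_ne_top WithTop.coe_ne_top hcon
  obtain ⟨c, hc⟩ := WithTop.ne_top_iff_exists.1 hcT
  rw [← hc] at hh hcon
  have hcb : c ≤ b := WithTop.coe_le_coe.1 hcon
  have hc0 : 0 < c := by
    have := swallowingTime_pos_holds hW' hz'0
    rw [← hc] at this
    exact WithTop.coe_pos.1 this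
  have hfar' : ∀ v : ℝ, 0 ≤ v → v < c → ((δ / 2 : ℝ≥0) : ℝ) ≤ ‖h v - W' v.toNNReal‖ := by
    intro v hv0 hvc
    have hvcT : (v.toNNReal : WithTop ℝ≥0) < (c : WithTop ℝ≥0) :=
      (mem_timeDomain_coe_iff.2 ⟨hv0, hvc⟩).2
    have hvb : v ≤ b := hvc.le.trans (NNReal.coe_le_coe.2 hcb)
    have h2 := hg.dist_le_of_driving_close hbT' hδ hfar hω0 hωδ hWW' hh hvb hvcT hsmall v ⟨hv0, le_rfl⟩
    have h2' : dist (h v) (g v) < δ / 4 :=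
      h2.trans_lt ((driverBound_mono dist_nonneg (by positivity) hω0 hvb).trans_lt hsmall)
    have h1 := hfar v ⟨hv0, hvb⟩
    have h5 := hWW' v ⟨hv0, hvb⟩
    rw [dist_eq_norm] at h2'
    push_cast
    have h3 : ‖g v - (W v.toNNReal : ℂ)‖ ≤
        ‖h v - W' v.toNNReal‖ + |W v.toNNReal - W' v.toNNReal| + ‖h v - g v‖ := by
      calc ‖g v - (W v.toNNReal : ℂ)‖
          = ‖(h v - W' v.toNNReal) - ((W v.toNNReal : ℂ) - W' v.toNNReal) - (h v - g v)‖ := by ring_nf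
        _ ≤ ‖(h v - W' v.toNNReal) - ((W v.toNNReal : ℂ) - W' v.toNNReal)‖ + ‖h v - g v‖ :=
          norm_sub_le _ _
        _ ≤ ‖h v - W' v.toNNReal‖ + ‖(W v.toNNReal : ℂ) - W' v.toNNReal‖ + ‖h v - g v‖ := by
          gcongr; exact norm_sub_le _ _
        _ = _ := by rw [← Complex.ofReal_sub, Complex.norm_real, Real.norm_eq_abs]
    linarith
  have := hh.coe_lt_swallowingTime_of_le_norm_sub hW' hc0 (half_pos hδ) hfar'
  rw [← hc] at this
  exact lt_irrefl _ this

/-- **Stability of the Loewner maps in the driving function, up to a fixed time**: with `z`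
flowing beyond `b` for the continuous `W`, `δ`-away from `W` on `[0, b]`, and `W'` continuous
with `|W - W'| ≤ ω ≤ δ/4` on `[0, b]`, every `z'` with `e₀ e^{Kb} + ω(e^{Kb} - 1) < δ/4`
(`e₀ = |z' - z|`, `K = 8/δ²`) flows beyond `b` for `W'`, and
`|g'_s(z') - g_s(z)| ≤ e₀ e^{Ks} + ω (e^{Ks} - 1)` for all `s ≤ b`.
[cite: Lawler2005, Ch. 4 §4.7 (Prop. 4.47)] -/
theorem dist_map_le_of_driving_close (hW : Continuous W) (hW' : Continuous W') {b : ℝ≥0}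
    (hzb : (b : WithTop ℝ≥0) < swallowingTime W z) {δ : ℝ≥0} (hδ : 0 < δ)
    (hfar : ∀ s : ℝ≥0, s ≤ b → (δ : ℝ) ≤ ‖map W s z - W s‖) {ω : ℝ} (hω0 : 0 ≤ ω)
    (hωδ : ω ≤ δ / 4) (hWW' : ∀ s : ℝ≥0, s ≤ b → |W s - W' s| ≤ ω)
    (hsmall : dist z' z * Real.exp (2 / ((δ : ℝ) / 2) ^ 2 * b) +
      ω * (Real.exp (2 / ((δ : ℝ) / 2) ^ 2 * b) - 1) < δ / 4) :
    (b : WithTop ℝ≥0) < swallowingTime W' z' ∧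
      ∀ s : ℝ≥0, s ≤ b → dist (map W' s z') (map W s z) ≤
        dist z' z * Real.exp (2 / ((δ : ℝ) / 2) ^ 2 * s) +
          ω * (Real.exp (2 / ((δ : ℝ) / 2) ^ 2 * s) - 1) := by
  have hz0 : z ≠ W 0 := ne_driving_of_lt_swallowingTime hzb
  obtain ⟨g, hg⟩ := exists_isSolution_swallowingTime_holds hW hz0
  -- transfer the hypotheses to the solution `g`
  have hfar' : ∀ t ∈ Icc 0 (b : ℝ), (δ : ℝ) ≤ ‖g t - W t.toNNReal‖ := by
    intro t ht
    have htb : t.toNNReal ≤ b := by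
      rw [← NNReal.coe_le_coe, Real.coe_toNNReal t ht.1]; exact ht.2
    have htT : ((t.toNNReal : ℝ≥0) : WithTop ℝ≥0) < swallowingTime W z :=
      lt_of_le_of_lt (WithTop.coe_le_coe.2 htb) hzb
    have h1 := hfar t.toNNReal htb
    rwa [map_eq_of_isSolution hW hg htT, Real.coe_toNNReal t ht.1] at h1
  have hWW'' : ∀ t ∈ Icc 0 (b : ℝ), |W t.toNNReal - W' t.toNNReal| ≤ ω := by
    intro t ht
    have htb : t.toNNReal ≤ b := by
      rw [← NNReal.coe_le_coe, Real.coe_toNNReal t ht.1]; exact ht.2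
    exact hWW' _ htb
  -- the maximal solution from `z'` for `W'`
  have hz'0 : z' ≠ W' 0 := by
    intro h0
    have h1 := hfar 0 bot_le
    have hm0 : map W 0 z = z := map_zero_apply hW hz0
    rw [hm0] at h1
    have h2 := hWW' 0 bot_le
    have h3 : dist z' z ≤ dist z' z * Real.exp (2 / ((δ : ℝ) / 2) ^ 2 * b) := by
      have : (1 : ℝ) ≤ Real.exp (2 / ((δ : ℝ) / 2) ^ 2 * b) := Real.one_le_exp (by positivity)
      nlinarith [dist_nonneg (x := z') (y := z)]
    have h4 : 0 ≤ ω * (Real.exp (2 / ((δ : ℝ) / 2) ^ 2 * b) - 1) :=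
      mul_nonneg hω0 (by linarith [Real.one_le_exp (show (0:ℝ) ≤ 2 / ((δ : ℝ) / 2) ^ 2 * b by positivity)])
    have h5 : ‖z - (W 0 : ℂ)‖ ≤ dist z' z + |W 0 - W' 0| := by
      calc ‖z - (W 0 : ℂ)‖ = ‖(z - z') + ((W' 0 : ℂ) - W 0)‖ := by rw [h0]; ring_nf
        _ ≤ ‖z - z'‖ + ‖(W' 0 : ℂ) - W 0‖ := norm_add_le _ _
        _ = dist z' z + |W 0 - W' 0| := by
          rw [← dist_eq_norm, dist_comm, ← Complex.ofReal_sub, Complex.norm_real, Real.norm_eq_abs,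
            abs_sub_comm]
    have hδ' : (0:ℝ) < δ := hδ
    linarith
  obtain ⟨h, hh⟩ := exists_isSolution_swallowingTime_holds hW' hz'0
  have halive := hg.lt_swallowingTime_of_driving_close hW' hzb hδ hfar' hω0 hωδ hWW'' hh hsmall
  refine ⟨halive, fun s hs ↦ ?_⟩
  have hsT : (s : WithTop ℝ≥0) < swallowingTime W z := lt_of_le_of_lt (WithTop.coe_le_coe.2 hs) hzb
  have hsT' : (s : WithTop ℝ≥0) < swallowingTime W' z' :=
    lt_of_le_of_lt (WithTop.coe_le_coe.2 hs) halive
  have hbT : (((b : ℝ)).toNNReal : WithTop ℝ≥0) < swallowingTime W z := by rwa [Real.toNNReal_coe]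
  have hsT'' : (((s : ℝ)).toNNReal : WithTop ℝ≥0) < swallowingTime W' z' := by rwa [Real.toNNReal_coe]
  rw [map_eq_of_isSolution hW hg hsT, map_eq_of_isSolution hW' hh hsT']
  exact hg.dist_le_of_driving_close hbT hδ hfar' hω0 hωδ hWW'' hh (NNReal.coe_le_coe.2 hs) hsT''
    hsmall s ⟨s.coe_nonneg, le_rfl⟩

end Loewner

end Literature.Probability.RandomPlanarGeometry

end
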